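import Summits.Langlands.Langlands.Theorems.IrreducibilityBySelfDualityIrreducibleOffSectorNonAutomorphicConstituent
import Summits.Langlands.Langlands.Theorems.IrreducibilityBySelfDualityIrreducibleOffSectorPlainConstituents
import Summits.Langlands.Langlands.Theorems.IrreducibilityBySelfDualityIrreducibleOffSectorRegularArithmetic
import Summits.Langlands.Langlands.Theorems.IrreducibilityBySelfDualityIrreducibleOffSectorOfArithmetic
import Summits.Langlands.Langlands.Theorems.IrreducibilityBySelfDualityIrreducibleOffSectorOfWeak
import HarnessLib

/-!
# A reducible avatar of a cuspidal `π` has a non-automorphic IRREDUCIBLE constituent of dimension `2 … n-1`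
(crux stmt-Langlands-14329 `IrreducibilityBySelfDuality.IrreducibleOffSector`, line `Sketch`;
`--supports` file, STRUCTURAL: no import of the route module; continuation lead c8, CONSTITUENT package)

`exists_block_not_weaklyAutomorphic_of_rational` (p130708) locates the failure of irreducibility of a
compatible `E`-rational avatar `ρ` of a cuspidal `π` in a block of rank `≥ 2` of ANY factorisation of
`det(X - ρ)`.  Fed with the Jordan–Hölder constituents of `ρ` (`exists_irreducible_constituents`,
p130975: irreducible `r_i` of positive ranks with `det(X - ρ) = ∏ det(X - r_i)`, trivial wherever `ρ`
is) it yields the constituent form, for EVERY rank `n`, EVERY number field `K` and EVERY cuspidal `π`: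

* `exists_irreducible_constituent_not_weaklyAutomorphic_of_rational` — granted Böckle–Hui Thm. 1.1
  (`hWA`, the `WeakAbelianSummandHecke` text), Arthur–Clozel (2.2) and (2.3): if `ρ` is
  Satake–Frobenius compatible with `(π, ι)` and `E`-rational at almost all places and NOT irreducible,
  then `ρ` has an IRREDUCIBLE constituent `r : Γ_K → GL_m(ℚ̄_ℓ)` with `2 ≤ m < n` (so `n ≥ 3`),
  `det(X - r) ∣ det(X - ρ)`, `r` trivial wherever `ρ` is (hence unramified almost everywhere), and `r`
  NOT weakly automorphic: no cuspidal datum on `GL_m(𝔸_K)` is Satake–Frobenius compatible with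
  `(r, ι)` at almost all places;
* `exists_rank_two_constituent_not_weaklyAutomorphic_of_rational` — rank `n = 3`, no (2.3)
  hypothesis (ranks `≤ 2` are theorems): a reducible compatible `E`-rational `ρ : Γ_K → GL_3(ℚ̄_ℓ)`
  has an irreducible TWO-dimensional constituent that is not weakly automorphic on `GL_2(𝔸_K)`;
* `exists_irreducible_constituent_not_weaklyAutomorphic_of_isRegular` — the same for `π`
  L-algebraic with a regular infinity type, `E`-rationality being Clozel's theorem (`hHE`, the
  `HeckeEigenvalueField` text; `exists_heckeField_of_isLAlgebraic_of_isRegular`,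
  `eventually_rational_of_esymm_mem`).

So, in every rank, "cuspidal ⇒ irreducible" for a given E-rational avatar is EQUIVALENT to the weak
automorphy of its irreducible constituents of dimensions `2 … n-1` — the rank-one constituents never
obstruct (Böckle–Hui), and the abelian / triangular shapes are excluded outright
(`…IrreducibleOffSectorNoAbelianAvatar`).

References: G. Böckle, C.-Y. Hui, Math. Ann. 393 (2025), Thm. 1.1, §3.2.1; N. Bourbaki, *Algèbre* VIII
(2012), §20 n°6; H. Jacquet, J. Shalika, Amer. J. Math. 103 (1981) II, Thm. 4.4; F. Calegari, T. Gee,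
Ann. Inst. Fourier 63 (2013), §1.1; L. Clozel (1990), Thm. 3.13.
-/

noncomputable section

set_option linter.dupNamespace false

open scoped NumberField Classical Polynomial
open Filter IsDedekindDomain Polynomial NumberField
open Literature.NumberTheory.Automorphic Literature.NumberTheory.GaloisRepresentations
open Summit.Langlands

namespace Summit.Langlands.Langlands.Theorems.IrreducibleOffSector

/-- **A reducible `E`-rational avatar of a cuspidal `π` has an irreducible constituent of dimension
`2 ≤ m < n` that is not weakly automorphic** (every rank, every number field, every cuspidal `π`).
Grant Böckle–Hui Thm. 1.1 in cofinite `GL(1)` form (`hWA`), Arthur–Clozel (2.2) (`h22`) and (2.3)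
(`h23`) for Borel–Jacquet data.  If `ρ : Γ_K → GL_n(ℚ̄_ℓ)` is Satake–Frobenius compatible with `(π, ι)`
and `E`-rational at almost all places and is NOT irreducible, then some irreducible constituent
`r : Γ_K → GL_m(ℚ̄_ℓ)` of `ρ` — `det(X - r σ) ∣ det(X - ρ σ)` for all `σ`, `r σ = 1` whenever `ρ σ = 1`
— has `2 ≤ m < n` and admits NO cuspidal datum on `GL_m(𝔸_K)` Satake–Frobenius compatible with it at
almost all places (`exists_irreducible_constituents` + `exists_block_not_weaklyAutomorphic_of_rational`).
[cite: BockleHui2025, Theorem 1.1 and §3.2.1] [cite: JacquetShalikaAJM1981II, Thm. 4.4] -/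
theorem exists_irreducible_constituent_not_weaklyAutomorphic_of_rational
    (hWA : ∀ (K : Type) [Field K] [NumberField K] (h1 : isCompact_glFiniteIntegralLevel 1 K) (ℓ : ℕ) [Fact ℓ.Prime] (n : ℕ) (E : Type) [Field E] [NumberField E] (e : E →+* PadicAlgCl ℓ) (ρ : Literature.NumberTheory.GaloisRepresentations.FramedGaloisRep K (PadicAlgCl ℓ) n), ρ.toGaloisRep.IsSemisimple → (∀ᶠ v in cofinite, ρ.IsUnramifiedAt v ∧ ∃ P : Polynomial E, ρ.HasFrobCharpolyAt v (P.map e)) → ∀ (ψ : Literature.NumberTheory.GaloisRepresentations.FramedGaloisRep K (PadicAlgCl ℓ) 1), (∀ᶠ v in cofinite, ρ.IsUnramifiedAt v ∧ ψ.IsUnramifiedAt v ∧ ∀ 𝔓 ∈ v.primesAbove, ∀ σ : Field.absoluteGaloisGroup K, IsArithFrobAt (NumberField.RingOfIntegers K) σ 𝔓 → ψ.charpoly σ ∣ ρ.charpoly σ) → ∀ (ι : PadicAlgCl ℓ ≃+* ℂ), ∃ χ : Literature.NumberTheory.Automorphic.CuspidalAutomorphicRepData 1 K h1, χ.1.IsRegularAlgebraic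 ∧ ∀ᶠ v in cofinite, ∃ c : ℂ, χ.1.HasSatakeParamAt v {c} ∧ ψ.IsUnramifiedAt v ∧ ψ.HasFrobCharpolyAt v (Literature.NumberTheory.Automorphic.arithFrobPolyOfSatake ι v.residueCard 1 {c}))
    (h22 : JacquetShalika1981_partialPairL_boundary_repData)
    (h23 : JacquetShalika1981_partialPairL_pole_repData)
    {K : Type} [Field K] [NumberField K] {n : ℕ} {hcpt : isCompact_glFiniteIntegralLevel n K}
    (hn : 0 < n) (π : CuspidalAutomorphicRepData n K hcpt)
    {ℓ : ℕ} [Fact ℓ.Prime] (ι : PadicAlgCl ℓ ≃+* ℂ) {E : Type} [Field E] [NumberField E]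
    (e : E →+* PadicAlgCl ℓ) (ρ : FramedGaloisRep K (PadicAlgCl ℓ) n)
    (hρ : ∀ᶠ v : HeightOneSpectrum (𝓞 K) in cofinite, SatakeFrobCompatibleAt ι π.1 ρ v)
    (hrat : ∀ᶠ v : HeightOneSpectrum (𝓞 K) in cofinite,
      ρ.IsUnramifiedAt v ∧ ∃ P : Polynomial E, ρ.HasFrobCharpolyAt v (P.map e))
    (hirr : ¬ ρ.toGaloisRep.IsIrreducible) :
    ∃ (m : ℕ) (r : FramedGaloisRep K (PadicAlgCl ℓ) m), 2 ≤ m ∧ m < n ∧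
      r.toGaloisRep.IsIrreducible ∧ (∀ g, r.charpoly g ∣ ρ.charpoly g) ∧ (∀ g, ρ g = 1 → r g = 1) ∧
      ∀ (hm : isCompact_glFiniteIntegralLevel m K) (σ : CuspidalAutomorphicRepData m K hm),
        ¬ ∀ᶠ v : HeightOneSpectrum (𝓞 K) in cofinite, SatakeFrobCompatibleAt ι σ.1 r v := by
  obtain ⟨k, m, r, -, hr, hchar, hker, hone⟩ := exists_irreducible_constituents ρ hn
  have hk2 : 2 ≤ k := by
    rcases Nat.lt_or_ge k 2 with hlt | hge
    · interval_cases k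
      · have hsum := sum_rank_eq_of_charpoly_eq_prod ρ r 1 (hchar 1)
        simp at hsum
        omega
      · exact absurd (hone rfl) hirr
    · exact hge
  have hsum : ∑ i, m i = n := sum_rank_eq_of_charpoly_eq_prod ρ r 1 (hchar 1)
  have hlt : ∀ i, m i < n := rank_lt_of_two_le hsum hk2 fun i => (hr i).1
  obtain ⟨i, hi2, hno⟩ := exists_block_not_weaklyAutomorphic_of_rational hWA h22 hn π ι e ρ hρ hrat
    hk2 (fun i => (hr i).1) (fun i => isCompact_glFiniteIntegralLevel_holds (m i) K)
    (fun i _ τ τ' => h23 (m i) K _ (hr i).1 τ τ') r hchar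
  refine ⟨m i, r i, hi2, hlt i, (hr i).2, fun g => ?_, fun g hg => hker g hg i, fun hm σ => hno σ⟩
  rw [hchar g]
  exact Finset.dvd_prod_of_mem _ (Finset.mem_univ i)

/-- **Rank three: a reducible `E`-rational avatar of a cuspidal `π` on `GL_3` has an irreducible
TWO-dimensional constituent that is not weakly automorphic on `GL_2(𝔸_K)`** (every `K`, every
cuspidal `π`; Böckle–Hui Thm. 1.1 `hWA` and Arthur–Clozel (2.2) only — (2.3) is needed in ranks
`≤ 2`, where it is a theorem of the tree).  Compare `exists_essSelfDual_of_not_isIrreducible_of_rational`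
(p117816: such a `π` is moreover essentially self-dual at Satake level).
[cite: BockleHui2025, Theorem 1.1 and §3.2.1] [cite: JacquetShalikaAJM1981II, Thm. 4.4] -/
theorem exists_rank_two_constituent_not_weaklyAutomorphic_of_rational
    (hWA : ∀ (K : Type) [Field K] [NumberField K] (h1 : isCompact_glFiniteIntegralLevel 1 K) (ℓ : ℕ) [Fact ℓ.Prime] (n : ℕ) (E : Type) [Field E] [NumberField E] (e : E →+* PadicAlgCl ℓ) (ρ : Literature.NumberTheory.GaloisRepresentations.FramedGaloisRep K (PadicAlgCl ℓ) n), ρ.toGaloisRep.IsSemisimple → (∀ᶠ v in cofinite, ρ.IsUnramifiedAt v ∧ ∃ P : Polynomial E, ρ.HasFrobCharpolyAt v (P.map e)) → ∀ (ψ : Literature.NumberTheory.GaloisRepresentations.FramedGaloisRep K (PadicAlgCl ℓ) 1), (∀ᶠ v in cofinite, ρ.IsUnramifiedAt v ∧ ψ.IsUnramifiedAt v ∧ ∀ 𝔓 ∈ v.primesAbove, ∀ σ : Field.absoluteGaloisGroup K, IsArithFrobAt (NumberField.RingOfIntegers K) σ 𝔓 → ψ.charpoly σ ∣ ρ.charpoly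 σ) → ∀ (ι : PadicAlgCl ℓ ≃+* ℂ), ∃ χ : Literature.NumberTheory.Automorphic.CuspidalAutomorphicRepData 1 K h1, χ.1.IsRegularAlgebraic ∧ ∀ᶠ v in cofinite, ∃ c : ℂ, χ.1.HasSatakeParamAt v {c} ∧ ψ.IsUnramifiedAt v ∧ ψ.HasFrobCharpolyAt v (Literature.NumberTheory.Automorphic.arithFrobPolyOfSatake ι v.residueCard 1 {c}))
    (h22 : JacquetShalika1981_partialPairL_boundary_repData)
    {K : Type} [Field K] [NumberField K] {hcpt : isCompact_glFiniteIntegralLevel 3 K}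
    (π : CuspidalAutomorphicRepData 3 K hcpt)
    {ℓ : ℕ} [Fact ℓ.Prime] (ι : PadicAlgCl ℓ ≃+* ℂ) {E : Type} [Field E] [NumberField E]
    (e : E →+* PadicAlgCl ℓ) (ρ : FramedGaloisRep K (PadicAlgCl ℓ) 3)
    (hρ : ∀ᶠ v : HeightOneSpectrum (𝓞 K) in cofinite, SatakeFrobCompatibleAt ι π.1 ρ v)
    (hrat : ∀ᶠ v : HeightOneSpectrum (𝓞 K) in cofinite,
      ρ.IsUnramifiedAt v ∧ ∃ P : Polynomial E, ρ.HasFrobCharpolyAt v (P.map e))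
    (hirr : ¬ ρ.toGaloisRep.IsIrreducible) :
    ∃ r : FramedGaloisRep K (PadicAlgCl ℓ) 2,
      r.toGaloisRep.IsIrreducible ∧ (∀ g, r.charpoly g ∣ ρ.charpoly g) ∧ (∀ g, ρ g = 1 → r g = 1) ∧
      ∀ (h2 : isCompact_glFiniteIntegralLevel 2 K) (σ : CuspidalAutomorphicRepData 2 K h2),
        ¬ ∀ᶠ v : HeightOneSpectrum (𝓞 K) in cofinite, SatakeFrobCompatibleAt ι σ.1 r v := by
  obtain ⟨k, m, r, -, hr, hchar, hker, hone⟩ := exists_irreducible_constituents ρ three_pos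
  have hk2 : 2 ≤ k := by
    rcases Nat.lt_or_ge k 2 with hlt | hge
    · interval_cases k
      · have hsum := sum_rank_eq_of_charpoly_eq_prod ρ r 1 (hchar 1)
        simp at hsum
      · exact absurd (hone rfl) hirr
    · exact hge
  have hsum : ∑ i, m i = 3 := sum_rank_eq_of_charpoly_eq_prod ρ r 1 (hchar 1)
  have hlt : ∀ i, m i < 3 := rank_lt_of_two_le hsum hk2 fun i => (hr i).1
  obtain ⟨i, hi2, hno⟩ := exists_block_not_weaklyAutomorphic_of_rational hWA h22 three_pos π ι e ρ hρ
    hrat hk2 (fun i => (hr i).1) (fun i => isCompact_glFiniteIntegralLevel_holds (m i) K)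
    (fun i h3 => absurd (hlt i) (by omega)) r hchar
  have hmi : m i = 2 := by have := hlt i; omega
  have hdvd : ∀ g, (r i).charpoly g ∣ ρ.charpoly g := fun g => by
    rw [hchar g]
    exact Finset.dvd_prod_of_mem _ (Finset.mem_univ i)
  -- transport the constituent `r i` from its nominal rank `m i = 2` to rank `2`
  suffices key : ∀ (d : ℕ), d = 2 → ∀ (r' : FramedGaloisRep K (PadicAlgCl ℓ) d),
      r'.toGaloisRep.IsIrreducible → (∀ g, r'.charpoly g ∣ ρ.charpoly g) → (∀ g, ρ g = 1 → r' g = 1) →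
      (∀ σ : CuspidalAutomorphicRepData d K (isCompact_glFiniteIntegralLevel_holds d K),
        ¬ ∀ᶠ v : HeightOneSpectrum (𝓞 K) in cofinite, SatakeFrobCompatibleAt ι σ.1 r' v) →
      ∃ r₂ : FramedGaloisRep K (PadicAlgCl ℓ) 2,
        r₂.toGaloisRep.IsIrreducible ∧ (∀ g, r₂.charpoly g ∣ ρ.charpoly g) ∧
        (∀ g, ρ g = 1 → r₂ g = 1) ∧
        ∀ (h2 : isCompact_glFiniteIntegralLevel 2 K) (σ : CuspidalAutomorphicRepData 2 K h2),
          ¬ ∀ᶠ v : HeightOneSpectrum (𝓞 K) in cofinite, SatakeFrobCompatibleAt ι σ.1 r₂ v from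
    key (m i) hmi (r i) (hr i).2 hdvd (fun g hg => hker g hg i) hno
  intro d hd r' h₁ h₂ h₃ h₄
  subst hd
  exact ⟨r', h₁, h₂, h₃, fun _ σ => h₄ σ⟩

/-- **Regular L-algebraic `π`: a reducible avatar has a non-automorphic irreducible constituent of
dimension `2 … n-1`** (every rank, every number field), modulo Böckle–Hui Thm. 1.1 (`hWA`), Clozel's
Hecke field (`hHE`, the `HeckeEigenvalueField` text) and Arthur–Clozel (2.2)–(2.3): for `π` cuspidal on
`GL_n(𝔸_K)`, L-algebraic with a regular infinity type, and `ρ` Satake–Frobenius compatible with `(π, ι)`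
at almost all places and not irreducible, some irreducible constituent `r : Γ_K → GL_m(ℚ̄_ℓ)` of `ρ`,
`2 ≤ m < n`, trivial wherever `ρ` is, admits no a.e.-compatible cuspidal datum on `GL_m(𝔸_K)`
(`E`-rationality of `ρ`: `exists_heckeField_of_isLAlgebraic_of_isRegular`, `eventually_rational_of_esymm_mem`).
[cite: Clozel1990, Thm. 3.13] [cite: BockleHui2025, Theorem 1.1 and §3.2.1] -/
theorem exists_irreducible_constituent_not_weaklyAutomorphic_of_isRegular
    (hWA : ∀ (K : Type) [Field K] [NumberField K] (h1 : isCompact_glFiniteIntegralLevel 1 K) (ℓ : ℕ) [Fact ℓ.Prime] (n : ℕ) (E : Type) [Field E] [NumberField E] (e : E →+* PadicAlgCl ℓ) (ρ : Literature.NumberTheory.GaloisRepresentations.FramedGaloisRep K (PadicAlgCl ℓ) n), ρ.toGaloisRep.IsSemisimple → (∀ᶠ v in cofinite, ρ.IsUnramifiedAt v ∧ ∃ P : Polynomial E, ρ.HasFrobCharpolyAt v (P.map e)) → ∀ (ψ : Literature.NumberTheory.GaloisRepresentations.FramedGaloisRep K (PadicAlgCl ℓ) 1), (∀ᶠ v in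 cofinite, ρ.IsUnramifiedAt v ∧ ψ.IsUnramifiedAt v ∧ ∀ 𝔓 ∈ v.primesAbove, ∀ σ : Field.absoluteGaloisGroup K, IsArithFrobAt (NumberField.RingOfIntegers K) σ 𝔓 → ψ.charpoly σ ∣ ρ.charpoly σ) → ∀ (ι : PadicAlgCl ℓ ≃+* ℂ), ∃ χ : Literature.NumberTheory.Automorphic.CuspidalAutomorphicRepData 1 K h1, χ.1.IsRegularAlgebraic ∧ ∀ᶠ v in cofinite, ∃ c : ℂ, χ.1.HasSatakeParamAt v {c} ∧ ψ.IsUnramifiedAt v ∧ ψ.HasFrobCharpolyAt v (Literature.NumberTheory.Automorphic.arithFrobPolyOfSatake ι v.residueCard 1 {c}))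
    (hHE : ∀ (n : ℕ) (K : Type) [Field K] [NumberField K] (hcpt : Literature.NumberTheory.Automorphic.isCompact_glFiniteIntegralLevel n K) (π : Literature.NumberTheory.Automorphic.CuspidalAutomorphicRepData n K hcpt), π.1.IsRegularAlgebraic → ∃ E : Subfield ℂ, FiniteDimensional ℚ E ∧ ∀ᶠ v in cofinite, ∀ α : Multiset ℂ, π.1.HasSatakeParamAt v α → ∀ i ≤ n, ((((Real.sqrt (v.residueCard : ℝ)) : ℝ) : ℂ) ^ (i * (n - i))) * α.esymm i ∈ E)
    (h22 : JacquetShalika1981_partialPairL_boundary_repData)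
    (h23 : JacquetShalika1981_partialPairL_pole_repData)
    {K : Type} [Field K] [NumberField K] {n : ℕ} {hcpt : isCompact_glFiniteIntegralLevel n K}
    (hn : 0 < n) (π : CuspidalAutomorphicRepData n K hcpt) (hL : π.1.IsLAlgebraic)
    (hreg : ∃ T : InfinityType K n, π.1.HasInfinityType T ∧ T.IsRegular)
    {ℓ : ℕ} [Fact ℓ.Prime] (ι : PadicAlgCl ℓ ≃+* ℂ) (ρ : FramedGaloisRep K (PadicAlgCl ℓ) n)
    (hρ : ∀ᶠ v : HeightOneSpectrum (𝓞 K) in cofinite, SatakeFrobCompatibleAt ι π.1 ρ v)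
    (hirr : ¬ ρ.toGaloisRep.IsIrreducible) :
    ∃ (m : ℕ) (r : FramedGaloisRep K (PadicAlgCl ℓ) m), 2 ≤ m ∧ m < n ∧
      r.toGaloisRep.IsIrreducible ∧ (∀ g, r.charpoly g ∣ ρ.charpoly g) ∧ (∀ g, ρ g = 1 → r g = 1) ∧
      ∀ (hm : isCompact_glFiniteIntegralLevel m K) (σ : CuspidalAutomorphicRepData m K hm),
        ¬ ∀ᶠ v : HeightOneSpectrum (𝓞 K) in cofinite, SatakeFrobCompatibleAt ι σ.1 r v := by
  haveI : NeZero n := ⟨hn.ne'⟩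
  obtain ⟨E, hfd, hE⟩ := exists_heckeField_of_isLAlgebraic_of_isRegular hHE π hL hreg
  haveI : FiniteDimensional ℚ E := hfd
  haveI : NumberField E := NumberField.mk
  exact exists_irreducible_constituent_not_weaklyAutomorphic_of_rational hWA h22 h23 hn π ι
    ((ι.symm : ℂ ≃+* PadicAlgCl ℓ).toRingHom.comp E.subtype) ρ hρ
    (eventually_rational_of_esymm_mem π.1 ι E hE ρ hρ) hirr

end Summit.Langlands.Langlands.Theorems.IrreducibleOffSector

end
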